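import Summits.AtomisticToContinuum.Crystallization.Theses.FluxTubeKepler
import Summits.AtomisticToContinuum.Crystallization.Theorems.FluxTubeKeplerFluxCellKeplerSplit
import Summits.AtomisticToContinuum.Crystallization.Theses.PhononSlackCertificates
import Summits.AtomisticToContinuum.Crystallization.Theorems.FluxTubeKeplerFluxCellKeplerDefectPricedOfGaps
import Summits.AtomisticToContinuum.Crystallization.Theorems.FluxTubeKeplerFluxCellKeplerEnergyIdentity

/-!
# Line `split-cellkepler` — skeleton for the BC2-redirect piece X₂ = `RealisedCellKepler` of crux `FluxTubeKepler.FluxCellKepler`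

Crux (after `route edit --split FluxCellKepler`): `RealisedCellKepler` = `∃ R₁ τ, REAL(τ) ∧ KEPLER⋆(τ)`
(a local credit sitewise dominating the confined cell energy of SOME admissible field on SOME
pairwise disjoint measurable cells, whose finite-range cell functional
`λ_i = (1/24) site₁₂ − τ_i/12` prices `(R,η)`-non-layered sites linearly above `N e⋆`).

PLAN A (this skeleton; typeable today, a CONSISTENCY plan — see the line card): the transversal cut
of the parent line `Sketch`, transported to the realised form and with the τ-free pricing replaced
by the board's two generic quantitative-crystallization statements (each strictly short of the
sub-problem on its own):

* `stub_realisedCoerciveCells` (the route's bet, flux form; XL) — `∃ R₁ τ, REAL(τ)` AND θ-SHARPNESS: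
  for every `δ > 0` some `θ < 1` with `Σ_i τ_i − Σ_i site₆,i ≤ 12 θ (E(x) − N e⋆)` on `δ`-separated
  configurations (the confinement defect eats at most a `θ`-fraction of the excess energy).  Not a
  consequence of the crux; fails if the cell functional has a soft mode the true energy lacks or a
  disordered family carries confinement defect comparable to its whole excess for every local rule.
* `stub_twoShellGap` = `PhononSlackCertificates.CoerciveTwoShellGap` (item 13956, shared BY NAME;
  open, XL): first/second-shell disorder at the fixed tolerance `1/20` is priced linearly above `N e⋆`.
* `stub_nearFieldConvexity` = `PhononSlackCertificates.NearFieldConvexity` (item 13958, shared BY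
  NAME; open, XL): among two-shell-good particles, failure of `η`-layering at radius 2 is priced
  linearly (with a boundary levy).

`RealisedCellKepler_of : stub₁ → CoerciveTwoShellGap → NearFieldConvexity → RealisedCellKepler` is
sorry-free: the two gaps give the τ-free pricing `c·#bad_(R,η) ≤ E − N e⋆`
(`FluxCellKeplerSketchGaps.stub_defectPricedExcess_of_gaps`, LANDED), and by the energy identity
`Σ_i λ_i = E − (Σ τ − Σ site₆)/12 ≥ E − θ(E − N e⋆)`, so `Σ_i λ_i − N e⋆ ≥ (1−θ) c · #bad`.
PLAN B (the route's intended programme — one-centre table + facet transfer for the NAMED credit) is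
NOT typeable until τ is named (definition requests on the line card).
-/

/-! ### Stand-in for the child decl (the split is filed, not yet applied)
`RealisedCellKepler` below is VERBATIM the statement filed for the child `FluxTubeKepler.RealisedCellKepler`
in `children.json` (= hypothesis `h₂` of the landed assembly `FluxCellKeplerSplit.FluxCellKepler_of_subs`,
p168076; `feeds_assembly` certifies this by `exact`).  Once `route edit --split FluxCellKepler` is applied,
delete the stand-in and let `RealisedCellKepler_of` conclude the route decl. -/

namespace Summit.AtomisticToContinuum.Crystallization.Cruxes.FluxCellKepler.SplitCellKepler

open scoped BigOperators
open MeasureTheory Literature.MathematicalPhysics.StatisticalMechanics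

/-- STAND-IN (verbatim the filed child statement `FluxTubeKepler.RealisedCellKepler`). [conjecture] -/
def RealisedCellKepler : Prop :=
  let ι : EuclideanSpace ℝ (Fin 3) → EuclideanSpace ℝ (Fin 8) := fun v => (EuclideanSpace.equiv (Fin 8) ℝ).symm (fun k => if h : (k : ℕ) < 3 then v ⟨k, h⟩ else 0); let π : EuclideanSpace ℝ (Fin 8) → EuclideanSpace ℝ (Fin 3) := fun y => (EuclideanSpace.equiv (Fin 3) ℝ).symm (fun k => y (Fin.castLE (by norm_num) k)); let t : ℝ → EuclideanSpace ℝ (Fin 3) → ℝ := fun a x₀ => sInf {e : ℝ | ∃ F : EuclideanSpace ℝ (Fin 8) → EuclideanSpace ℝ (Fin 8), MemLp F 2 volume ∧ (∀ φ : EuclideanSpace ℝ (Fin 8) → ℝ, ContDiff ℝ 1 φ → HasCompactSupport φ → ∫ y, inner ℝ (F y) (gradient φ y) = -(((volume (Metric.ball (ι x₀) a)).toReal)⁻¹ * ∫ y in Metric.ball (ι x₀) a, φ y)) ∧ e = ∫ y, ‖F y‖ ^ 2}; ∃ (R₁ : ℝ) (τ : Finset (EuclideanSpace ℝ (Fin 3))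 → ℝ), (∀ (N : ℕ) (x : Fin N → EuclideanSpace ℝ (Fin 3)), Function.Injective x → ∃ a : ℝ, 0 < a ∧ (∀ i j, i ≠ j → 2 * a < dist (x i) (x j)) ∧ ∃ (Ω : Fin N → Set (EuclideanSpace ℝ (Fin 3))) (G : EuclideanSpace ℝ (Fin 8) → EuclideanSpace ℝ (Fin 8)), (Pairwise fun i j => Disjoint (Ω i) (Ω j)) ∧ (∀ i, MeasurableSet (Ω i)) ∧ MemLp G 2 volume ∧ (∀ y, π y ∉ (⋃ i, Ω i) → G y = 0) ∧ (∀ φ : EuclideanSpace ℝ (Fin 8) → ℝ, ContDiff ℝ 1 φ → HasCompactSupport φ → ∫ y, inner ℝ (G y) (gradient φ y) = -∑ i, ((volume (Metric.ball (ι (x i)) a)).toReal)⁻¹ * ∫ y in Metric.ball (ι (x i)) a, φ y) ∧ ∀ i, 2 * Real.pi ^ 4 * ((∫ y in {y | π y ∈ Ω i}, ‖G y‖ ^ 2) - t a (x i)) ≤ τ ((Finset.univ.filter fun j : Fin N => dist (x j) (x i) ≤ R₁).image fun j => x j - x i)) ∧ (∀ δ : ℝ, 0 < δ → ∀ R η :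 ℝ, 0 < R → 0 < η → ∃ c : ℝ, 0 < c ∧ ∀ (N : ℕ) (x : Fin N → EuclideanSpace ℝ (Fin 3)), Function.Injective x → (∀ i j, i ≠ j → δ ≤ dist (x i) (x j)) → c * (Nat.card {i : Fin N // ¬ ∃ a : ℝ, 47 / 50 ≤ a ∧ a ≤ 1 ∧ ∃ (A : EuclideanSpace ℝ (Fin 3) →ₗᵢ[ℝ] EuclideanSpace ℝ (Fin 3)) (s : ℤ → ℤ) (z : ℤ → ℝ), IsHaggSeq s ∧ (∀ m : ℤ, 39 / 50 * a ≤ z (m + 1) - z m ∧ z (m + 1) - z m ≤ 17 / 20 * a) ∧ let S : Set (EuclideanSpace ℝ (Fin 3)) := {p | ∃ m k l : ℤ, p = A (((k : ℝ) • triangularVec₁ a) + ((l : ℝ) • triangularVec₂ a) + ((haggLabel s m : ℝ) • barlowOffset a) + (z m • layerNormal 1))}; (∀ p ∈ S, ‖p‖ ≤ R → ∃ j : Fin N, dist (x j - x i) p ≤ η) ∧ (∀ j : Fin N, ‖x j - x i‖ ≤ R → ∃ p ∈ S, dist (x j - x i) p ≤ η)} : ℝ) ≤ ∑ i, ((1 /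 24 : ℝ) * siteEnergy (fun r => (r⁻¹) ^ 12) x i - (1 / 12 : ℝ) * τ ((Finset.univ.filter fun j : Fin N => dist (x j) (x i) ≤ R₁).image fun j => x j - x i)) - (N : ℝ) * ⨅ Q : PeriodicConfiguration 3, Q.energyPerParticle lennardJones)

/-- **Stub 1 — realised coercive flux cells** (REAL ∧ θ-sharpness; see module docstring). [conjecture] -/
theorem stub_realisedCoerciveCells :
    let ι : EuclideanSpace ℝ (Fin 3) → EuclideanSpace ℝ (Fin 8) := fun v => (EuclideanSpace.equiv (Fin 8) ℝ).symm (fun k => if h : (k : ℕ) < 3 then v ⟨k, h⟩ else 0); let π : EuclideanSpace ℝ (Fin 8) → EuclideanSpace ℝ (Fin 3) := fun y => (EuclideanSpace.equiv (Fin 3) ℝ).symm (fun k => y (Fin.castLE (by norm_num) k)); let t : ℝ → EuclideanSpace ℝ (Fin 3) → ℝ := fun a x₀ => sInf {e : ℝ | ∃ F : EuclideanSpace ℝ (Fin 8) → EuclideanSpace ℝ (Fin 8), MemLp F 2 volume ∧ (∀ φ : EuclideanSpace ℝ (Fin 8) → ℝ, ContDiff ℝ 1 φ → HasCompactSupport φ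 → ∫ y, inner ℝ (F y) (gradient φ y) = -(((volume (Metric.ball (ι x₀) a)).toReal)⁻¹ * ∫ y in Metric.ball (ι x₀) a, φ y)) ∧ e = ∫ y, ‖F y‖ ^ 2}; ∃ (R₁ : ℝ) (τ : Finset (EuclideanSpace ℝ (Fin 3)) → ℝ), (∀ (N : ℕ) (x : Fin N → EuclideanSpace ℝ (Fin 3)), Function.Injective x → ∃ a : ℝ, 0 < a ∧ (∀ i j, i ≠ j → 2 * a < dist (x i) (x j)) ∧ ∃ (Ω : Fin N → Set (EuclideanSpace ℝ (Fin 3))) (G : EuclideanSpace ℝ (Fin 8) → EuclideanSpace ℝ (Fin 8)), (Pairwise fun i j => Disjoint (Ω i) (Ω j)) ∧ (∀ i, MeasurableSet (Ω i)) ∧ MemLp G 2 volume ∧ (∀ y, π y ∉ (⋃ i, Ω i) → G y = 0) ∧ (∀ φ : EuclideanSpace ℝ (Fin 8) → ℝ, ContDiff ℝ 1 φ → HasCompactSupport φ → ∫ y, inner ℝ (G y) (gradient φ y) = -∑ i, ((volume (Metric.ball (ι (x i)) a)).toReal)⁻¹ * ∫ y in Metric.ball (ι (x i)) a, φ y) ∧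 ∀ i, 2 * Real.pi ^ 4 * ((∫ y in {y | π y ∈ Ω i}, ‖G y‖ ^ 2) - t a (x i)) ≤ τ ((Finset.univ.filter fun j : Fin N => dist (x j) (x i) ≤ R₁).image fun j => x j - x i)) ∧ (∀ δ : ℝ, 0 < δ → ∃ θ : ℝ, θ < 1 ∧ ∀ (N : ℕ) (x : Fin N → EuclideanSpace ℝ (Fin 3)), Function.Injective x → (∀ i j, i ≠ j → δ ≤ dist (x i) (x j)) → ∑ i, τ ((Finset.univ.filter fun j : Fin N => dist (x j) (x i) ≤ R₁).image fun j => x j - x i) - ∑ i, siteEnergy (fun r => (r⁻¹) ^ 6) x i ≤ 12 * θ * (interactionEnergy lennardJones x - (N : ℝ) * ⨅ Q : PeriodicConfiguration 3, Q.energyPerParticle lennardJones)) := by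
  sorry

/-- **Stub 2 — the coercive two-shell gap** (item stmt-AtomisticToContinuum-13956, by name). [conjecture] -/
theorem stub_twoShellGap :
    Summit.AtomisticToContinuum.Crystallization.Theses.PhononSlackCertificates.CoerciveTwoShellGap := by
  sorry

/-- **Stub 3 — near-field convexity over the layered family** (item stmt-AtomisticToContinuum-13958,
by name). [conjecture] -/
theorem stub_nearFieldConvexity :
    Summit.AtomisticToContinuum.Crystallization.Theses.PhononSlackCertificates.NearFieldConvexity := by
  sorry

/-- Statement of `stub_realisedCoerciveCells` (verbatim). [conjecture] -/
def Sig.stub_realisedCoerciveCells : Prop :=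
  let ι : EuclideanSpace ℝ (Fin 3) → EuclideanSpace ℝ (Fin 8) := fun v => (EuclideanSpace.equiv (Fin 8) ℝ).symm (fun k => if h : (k : ℕ) < 3 then v ⟨k, h⟩ else 0); let π : EuclideanSpace ℝ (Fin 8) → EuclideanSpace ℝ (Fin 3) := fun y => (EuclideanSpace.equiv (Fin 3) ℝ).symm (fun k => y (Fin.castLE (by norm_num) k)); let t : ℝ → EuclideanSpace ℝ (Fin 3) → ℝ := fun a x₀ => sInf {e : ℝ | ∃ F : EuclideanSpace ℝ (Fin 8) → EuclideanSpace ℝ (Fin 8), MemLp F 2 volume ∧ (∀ φ : EuclideanSpace ℝ (Fin 8) → ℝ, ContDiff ℝ 1 φ → HasCompactSupport φ → ∫ y, inner ℝ (F y) (gradient φ y) = -(((volume (Metric.ball (ι x₀) a)).toReal)⁻¹ * ∫ y in Metric.ball (ι x₀) a, φ y)) ∧ e = ∫ y, ‖F y‖ ^ 2}; ∃ (R₁ : ℝ) (τ : Finset (EuclideanSpace ℝ (Fin 3)) → ℝ), (∀ (N : ℕ) (x : Fin N → EuclideanSpace ℝ (Fin 3)), Function.Injective x → ∃ a : ℝ,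 0 < a ∧ (∀ i j, i ≠ j → 2 * a < dist (x i) (x j)) ∧ ∃ (Ω : Fin N → Set (EuclideanSpace ℝ (Fin 3))) (G : EuclideanSpace ℝ (Fin 8) → EuclideanSpace ℝ (Fin 8)), (Pairwise fun i j => Disjoint (Ω i) (Ω j)) ∧ (∀ i, MeasurableSet (Ω i)) ∧ MemLp G 2 volume ∧ (∀ y, π y ∉ (⋃ i, Ω i) → G y = 0) ∧ (∀ φ : EuclideanSpace ℝ (Fin 8) → ℝ, ContDiff ℝ 1 φ → HasCompactSupport φ → ∫ y, inner ℝ (G y) (gradient φ y) = -∑ i, ((volume (Metric.ball (ι (x i)) a)).toReal)⁻¹ * ∫ y in Metric.ball (ι (x i)) a, φ y) ∧ ∀ i, 2 * Real.pi ^ 4 * ((∫ y in {y | π y ∈ Ω i}, ‖G y‖ ^ 2) - t a (x i)) ≤ τ ((Finset.univ.filter fun j : Fin N => dist (x j) (x i) ≤ R₁).image fun j => x j - x i)) ∧ (∀ δ : ℝ, 0 < δ → ∃ θ : ℝ, θ < 1 ∧ ∀ (N : ℕ) (x : Fin N → EuclideanSpace ℝ (Fin 3)), Function.Injective x → (∀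 i j, i ≠ j → δ ≤ dist (x i) (x j)) → ∑ i, τ ((Finset.univ.filter fun j : Fin N => dist (x j) (x i) ≤ R₁).image fun j => x j - x i) - ∑ i, siteEnergy (fun r => (r⁻¹) ^ 6) x i ≤ 12 * θ * (interactionEnergy lennardJones x - (N : ℝ) * ⨅ Q : PeriodicConfiguration 3, Q.energyPerParticle lennardJones))

/-- **Assembly** (sorry-free): the crux `FluxTubeKepler.RealisedCellKepler` BY NAME from the three
stub statements (see module docstring). [folklore] -/
theorem RealisedCellKepler_of (h₁ : Sig.stub_realisedCoerciveCells)
    (hG : Summit.AtomisticToContinuum.Crystallization.Theses.PhononSlackCertificates.CoerciveTwoShellGap)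
    (hNF : Summit.AtomisticToContinuum.Crystallization.Theses.PhononSlackCertificates.NearFieldConvexity) :
    RealisedCellKepler := by
  dsimp only [Sig.stub_realisedCoerciveCells,
    RealisedCellKepler] at h₁ ⊢
  have hprice :=
    Summit.AtomisticToContinuum.Crystallization.Theorems.FluxCellKeplerSketchGaps.stub_defectPricedExcess_of_gaps
      hG hNF
  obtain ⟨R₁, τ, hreal, hsharp⟩ := h₁
  refine ⟨R₁, τ, hreal, ?_⟩
  intro δ hδ R η hR hη
  obtain ⟨θ, hθ, hθb⟩ := hsharp δ hδ
  obtain ⟨c, hc, hcb⟩ := hprice δ hδ R η hR hη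
  refine ⟨(1 - θ) * c, mul_pos (sub_pos.2 hθ) hc, fun N x hx hsep => ?_⟩
  have hGc := hcb N x hx hsep
  have hL := hθb N x hx hsep
  have hsum : ∑ i, ((1 / 24 : ℝ) * siteEnergy (fun r => (r⁻¹) ^ 12) x i
        - (1 / 12 : ℝ) * τ ((Finset.univ.filter fun j : Fin N => dist (x j) (x i) ≤ R₁).image fun j => x j - x i))
      = interactionEnergy lennardJones x
        - (1 / 12 : ℝ) * (∑ i, τ ((Finset.univ.filter fun j : Fin N => dist (x j) (x i) ≤ R₁).image fun j => x j - x i)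
            - ∑ i, siteEnergy (fun r => (r⁻¹) ^ 6) x i) := by
    rw [Summit.AtomisticToContinuum.Crystallization.Theorems.FluxCellKeplerSketch.interactionEnergy_lennardJones_eq_sum x,
      Finset.sum_sub_distrib, Finset.sum_sub_distrib, ← Finset.mul_sum, ← Finset.mul_sum, ← Finset.mul_sum]
    ring
  rw [hsum]
  have h1 : (1 - θ) * (c * (Nat.card {i : Fin N // ¬ ∃ a : ℝ, 47 / 50 ≤ a ∧ a ≤ 1 ∧ ∃ (A : EuclideanSpace ℝ (Fin 3) →ₗᵢ[ℝ] EuclideanSpace ℝ (Fin 3)) (s : ℤ → ℤ) (z : ℤ → ℝ), IsHaggSeq s ∧ (∀ m : ℤ, 39 / 50 * a ≤ z (m + 1) - z m ∧ z (m + 1) - z m ≤ 17 / 20 * a) ∧ let S : Set (EuclideanSpace ℝ (Fin 3)) := {p | ∃ m k l : ℤ, p = A (((k : ℝ) • triangularVec₁ a) + ((l : ℝ) • triangularVec₂ a) + ((haggLabel s m : ℝ) • barlowOffset a) + (z m • layerNormal 1))}; (∀ p ∈ S, ‖p‖ ≤ R → ∃ j : Fin N, dist (x j - x i) p ≤ η)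 ∧ (∀ j : Fin N, ‖x j - x i‖ ≤ R → ∃ p ∈ S, dist (x j - x i) p ≤ η)} : ℝ))
      ≤ (1 - θ) * (interactionEnergy lennardJones x - (N : ℝ) * ⨅ Q : PeriodicConfiguration 3, Q.energyPerParticle lennardJones) :=
    mul_le_mul_of_nonneg_left hGc (sub_nonneg.2 hθ.le)
  nlinarith [h1, hL]

/-- **The closed skeleton instance**: the crux by name from the declared stubs (the only `sorry`s). -/
theorem RealisedCellKepler_skeleton :
    RealisedCellKepler :=
  RealisedCellKepler_of stub_realisedCoerciveCells stub_twoShellGap stub_nearFieldConvexity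

/-- **The stand-in feeds the landed assembly**: the filed sibling statement `FluxTubeDomination` and
`RealisedCellKepler` (this file) give the parent crux `FluxTubeKepler.FluxCellKepler` by the landed
`FluxCellKeplerSplit.FluxCellKepler_of_subs` (p168076) — by `exact`, so the stand-in is verbatim. [folklore] -/
theorem feeds_assembly
    (h₁ : let ι : EuclideanSpace ℝ (Fin 3) → EuclideanSpace ℝ (Fin 8) := fun v => (EuclideanSpace.equiv (Fin 8) ℝ).symm (fun k => if h : (k : ℕ) < 3 then v ⟨k, h⟩ else 0); let π : EuclideanSpace ℝ (Fin 8) → EuclideanSpace ℝ (Fin 3) := fun y => (EuclideanSpace.equiv (Fin 3) ℝ).symm (fun k => y (Fin.castLE (by norm_num) k)); let t : ℝ → EuclideanSpace ℝ (Fin 3) → ℝ := fun a x₀ => sInf {e : ℝ | ∃ F : EuclideanSpace ℝ (Fin 8) → EuclideanSpace ℝ (Fin 8), MemLp F 2 volume ∧ (∀ φ : EuclideanSpace ℝ (Fin 8) → ℝ, ContDiff ℝ 1 φ → HasCompactSupport φ → ∫ y, inner ℝ (F y) (gradient φ y) = -(((volume (Metric.ball (ι x₀) a)).toReal)⁻¹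 * ∫ y in Metric.ball (ι x₀) a, φ y)) ∧ e = ∫ y, ‖F y‖ ^ 2}; ∀ a : ℝ, 0 < a → ∀ (N : ℕ) (x : Fin N → EuclideanSpace ℝ (Fin 3)), (∀ i j, i ≠ j → 2 * a < dist (x i) (x j)) → ∀ (Ω : Fin N → Set (EuclideanSpace ℝ (Fin 3))) (G : EuclideanSpace ℝ (Fin 8) → EuclideanSpace ℝ (Fin 8)), (Pairwise fun i j => Disjoint (Ω i) (Ω j)) → (∀ i, MeasurableSet (Ω i)) → MemLp G 2 volume → (∀ y, π y ∉ (⋃ i, Ω i) → G y = 0) → (∀ φ : EuclideanSpace ℝ (Fin 8) → ℝ, ContDiff ℝ 1 φ → HasCompactSupport φ → ∫ y, inner ℝ (G y) (gradient φ y) = -∑ i, ((volume (Metric.ball (ι (x i)) a)).toReal)⁻¹ * ∫ y in Metric.ball (ι (x i)) a, φ y) → ∑ i, siteEnergy (fun r => (r⁻¹) ^ 6) x i ≤ 2 * Real.pi ^ 4 * ∑ i, ((∫ y in {y | π y ∈ Ω i}, ‖G y‖ ^ 2) - t a (x i)))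
    (h₂ : RealisedCellKepler) :
    Summit.AtomisticToContinuum.Crystallization.Theses.FluxTubeKepler.FluxCellKepler :=
  Summit.AtomisticToContinuum.Crystallization.Theorems.FluxCellKeplerSplit.FluxCellKepler_of_subs h₁ h₂

end Summit.AtomisticToContinuum.Crystallization.Cruxes.FluxCellKepler.SplitCellKepler
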